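import Mathlib
import HarnessLib
import Literature.MathematicalPhysics.QuantumLattice.HubbardFermiRadiusBandSmooth

/-!
# Route `KLProgramme` — ENGINE crux `KLRegimeEngineV17F2` (stmt-HubbardSuperconductivity-20437), row (C) `stub_twoLeg_curvature`,
# producer hypothesis `hcertA : KlwjCertA` — KLWJ-INKERNEL part 1a: JET EXPRESSIONS AND THE FORMAL CURVE DERIVATION (definitions)
# (cell gate-hubbard-kl, seat hubbard-kl-k3c5-p1 g21; docket «KLWJ-INKERNEL-ROUTE» (p1b g19 memo 5340b98f1348eb46); 0 kit)

Free band `ε₀(k) = -2(cos k₁ + cos k₂)`, polar level function `F(θ, t) = ε₀(t·dir θ) = -2(cos(t cos θ) + cos(t sin θ))`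
(`rayDispersion`), polar Fermi radius `u = u_μ(θ) = bandFermiRadius μ θ` (`F(θ, u_μ(θ)) = μ`, `-4 < μ < 0`), radial slope
`W = ∂_tF(θ, u)` (`rayDispersionDt`, positive along the curve), angular slope `u' = -∂_θF/∂_tF` (`bandFermiRadiusDeriv`,
`hasDerivAt_bandFermiRadius`).

THE POINT OF THIS FILE.  Along the curve `θ ↦ (θ, u_μ(θ))` the seven ATOMS
`a₀ … a₆ = cos θ, sin θ, u, sin(u cos θ), cos(u cos θ), sin(u sin θ), cos(u sin θ)`
generate a differential ring: `d/dθ` of each atom is a polynomial in the atoms and `u'`, and `u' = -∂_θF/∂_tF` is a polynomial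
in the atoms divided by `W = 2(a₀a₃ + a₁a₅)`.  Hence EVERY angular derivative of `u`, of `W` (the table's radial slope
`D_μ = freeRadialSlope μ`) and of the polar Jacobian `J = u/W` (`freePolarJac μ`) is `P(a)/Wⁿ` for an explicit integer polynomial `P`.
We make this SYNTACTIC: a small expression type `JE` (atoms, integer constants, `+`, `×`, `−`, division by a power of `W`), its real
semantics `JE.eval`, and a FORMAL CURVE DERIVATION `JE.Dc : JE → JE` (THIS FILE: the definitions and the evaluation lemmas of the
smart constructors; the soundness theorem `hasDerivAt_eval_Dc` — `d/dθ ⟦e⟧(θ, u_μ θ) = ⟦Dc e⟧(θ, u_μ θ)` — and the three towers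
`iteratedDeriv k (bandFermiRadius μ) = ⟦Dc^[k] (atom 2)⟧`, … are part 1b `…FreeBandJetAlgebra`).
No closed form of any higher derivative is ever typed: the terms `Dc^[k] e` are computed by the kernel when a consumer needs them
(part 2, `…FreeBandJetCheck`: a kernel-checked interval evaluation of exactly these terms on boxes certifies the twelve derivative
entries of `klwjTableA`).  The smart constructors `add'/mul'/neg'/divW'` (`0 + e = e`, `0·e = 0`, `1·e = e`, constant folding,
`-(-e) = e`) keep the terms small; they are part of the DEFINITION of `Dc` (the certificate generator mirrors them byte for byte).

Honest framing: elementary calculus of the FREE dispersion, generic in the level `μ ∈ (-4, 0)`; nothing here asserts any table entry,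
row (C), any stub of 20437, K3, U₀, the window, a margin or superconductivity in the Hubbard model.
References: BGM 2006 §2.4 Lemma 2.1 (2.40) (polar description of the free Fermi curve) [cite: BenfattoGiulianiMastropietro2006];
forward-mode differentiation of straight-line programs (Griewank–Walther, *Evaluating Derivatives*, 2nd ed., SIAM 2008, §3.1) [folklore].
-/

noncomputable section

namespace Summit.HubbardSuperconductivity.HubbardSuperconductivity.Theorems.FreeBandJets

set_option linter.dupNamespace false -- summit = problem name (single-conjunct summit), D-0017

open Real Set Literature.MathematicalPhysics.QuantumLattice

/-! ## §1 Jet expressions, their real semantics, smart constructors -/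

/-- **Jet expressions**: integer polynomials in numbered atoms, divided by powers of the radial slope `W`
(`divW e n` denotes `e / Wⁿ`).  Atoms `0 … 6` are `cos θ, sin θ, t, sin(t cos θ), cos(t cos θ), sin(t sin θ), cos(t sin θ)`;
atoms `≥ 7` denote `0`. -/
inductive JE : Type
  /-- the `i`-th atom -/
  | atom (i : ℕ) : JE
  /-- an integer constant -/
  | const (z : ℤ) : JE
  /-- sum -/
  | add (a b : JE) : JE
  /-- product -/
  | mul (a b : JE) : JE
  /-- negation -/
  | neg (a : JE) : JE
  /-- `a / Wⁿ`, `W` the radial slope -/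
  | divW (a : JE) (n : ℕ) : JE
  deriving DecidableEq, Inhabited, Repr

namespace JE

/-- The radial slope `W = 2(a₀a₃ + a₁a₅)` of an atom assignment (`= ∂_tF` at `(θ, t)`, `wval_atomsAt`). -/
def wval (A : ℕ → ℝ) : ℝ := 2 * (A 0 * A 3 + A 1 * A 5)

/-- Real semantics of a jet expression under an atom assignment. -/
def eval (A : ℕ → ℝ) : JE → ℝ
  | atom i => A i
  | const z => z
  | add a b => eval A a + eval A b
  | mul a b => eval A a * eval A b
  | neg a => -eval A a
  | divW a n => eval A a / wval A ^ n

/-- Semantics of an atom. -/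
@[simp] theorem eval_atom (A : ℕ → ℝ) (i : ℕ) : eval A (atom i) = A i := rfl
/-- Semantics of a constant. -/
@[simp] theorem eval_const (A : ℕ → ℝ) (z : ℤ) : eval A (const z) = z := rfl
/-- Semantics of a sum. -/
@[simp] theorem eval_add (A : ℕ → ℝ) (a b : JE) : eval A (add a b) = eval A a + eval A b := rfl
/-- Semantics of a product. -/
@[simp] theorem eval_mul (A : ℕ → ℝ) (a b : JE) : eval A (mul a b) = eval A a * eval A b := rfl
/-- Semantics of a negation. -/
@[simp] theorem eval_neg (A : ℕ → ℝ) (a : JE) : eval A (neg a) = -eval A a := rfl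
/-- Semantics of a division by `Wⁿ`. -/
@[simp] theorem eval_divW (A : ℕ → ℝ) (a : JE) (n : ℕ) : eval A (divW a n) = eval A a / wval A ^ n := rfl

/-- `e` is the constant `0`. -/
def isZero : JE → Bool
  | const z => z == 0
  | _ => false

/-- `e` is the constant `1`. -/
def isOne : JE → Bool
  | const z => z == 1
  | _ => false

/-- An expression recognised as `0` evaluates to `0`. -/
theorem eval_of_isZero {e : JE} (h : e.isZero = true) (A : ℕ → ℝ) : eval A e = 0 := by
  cases e <;> simp_all [isZero]

/-- An expression recognised as `1` evaluates to `1`. -/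
theorem eval_of_isOne {e : JE} (h : e.isOne = true) (A : ℕ → ℝ) : eval A e = 1 := by
  cases e <;> simp_all [isOne]

/-- Smart sum: `0 + b = b`, `a + 0 = a`, constants folded. -/
def add' (a b : JE) : JE :=
  if a.isZero then b else if b.isZero then a else
    match a, b with
    | const x, const y => const (x + y)
    | _, _ => add a b

/-- Smart negation: constants folded, `-(-a) = a`. -/
def neg' : JE → JE
  | const z => const (-z)
  | neg a => a
  | a => neg a

/-- Smart difference `a + (-b)`. -/
def sub' (a b : JE) : JE := add' a (neg' b)

/-- Smart product: `0·b = a·0 = 0`, `1·b = b`, `a·1 = a`, constants folded. -/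
def mul' (a b : JE) : JE :=
  if a.isZero || b.isZero then const 0 else if a.isOne then b else if b.isOne then a else
    match a, b with
    | const x, const y => const (x * y)
    | _, _ => mul a b

/-- Smart integer multiple. -/
def smul' (k : ℤ) (a : JE) : JE := mul' (const k) a

/-- Smart division by `Wⁿ`: `0 / Wⁿ = 0`, `a / W⁰ = a`. -/
def divW' (a : JE) (n : ℕ) : JE :=
  if a.isZero then const 0 else if n = 0 then a else divW a n

/-- The smart sum is a sum. -/
@[simp] theorem eval_add' (A : ℕ → ℝ) (a b : JE) : eval A (add' a b) = eval A a + eval A b := by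
  unfold add'
  split
  · rename_i h; rw [eval_of_isZero h]; ring
  split
  · rename_i h; rw [eval_of_isZero h]; ring
  split <;> simp [eval]

/-- The smart negation is a negation. -/
@[simp] theorem eval_neg' (A : ℕ → ℝ) (a : JE) : eval A (neg' a) = -eval A a := by
  cases a <;> simp [neg', eval]

/-- The smart difference is a difference. -/
@[simp] theorem eval_sub' (A : ℕ → ℝ) (a b : JE) : eval A (sub' a b) = eval A a - eval A b := by
  simp [sub', sub_eq_add_neg]

/-- The smart product is a product. -/
@[simp] theorem eval_mul' (A : ℕ → ℝ) (a b : JE) : eval A (mul' a b) = eval A a * eval A b := by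
  unfold mul'
  by_cases h0 : (a.isZero || b.isZero) = true
  · simp only [Bool.or_eq_true] at h0
    rcases h0 with h | h <;> simp [h, eval_of_isZero h]
  · rw [if_neg h0]
    by_cases h1 : a.isOne = true
    · simp [h1, eval_of_isOne h1]
    · rw [if_neg h1]
      by_cases h2 : b.isOne = true
      · simp [h2, eval_of_isOne h2]
      · rw [if_neg h2]
        split <;> simp [eval]

/-- The smart integer multiple is an integer multiple. -/
@[simp] theorem eval_smul' (A : ℕ → ℝ) (k : ℤ) (a : JE) : eval A (smul' k a) = k * eval A a := by
  simp [smul']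

/-- The smart division by `Wⁿ` is a division by `Wⁿ`. -/
@[simp] theorem eval_divW' (A : ℕ → ℝ) (a : JE) (n : ℕ) : eval A (divW' a n) = eval A a / wval A ^ n := by
  unfold divW'
  by_cases h : a.isZero = true
  · simp [h, eval_of_isZero h]
  · by_cases hn : n = 0
    · subst hn; simp [h]
    · simp [h, hn]

/-! ## §2 The tables of the two partial derivations on the atoms and the curve derivation `Dc` -/

/-- `∂_θ` of the atoms (`t` held fixed): `cos θ ↦ -sin θ`, `sin θ ↦ cos θ`, `t ↦ 0`, `sin(t cos θ) ↦ cos(t cos θ)·(-(t sin θ))`, … -/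
def TTH : ℕ → JE
  | 0 => neg (atom 1)
  | 1 => atom 0
  | 3 => mul (atom 4) (neg (mul (atom 2) (atom 1)))
  | 4 => mul (atom 3) (mul (atom 2) (atom 1))
  | 5 => mul (atom 6) (mul (atom 2) (atom 0))
  | 6 => neg (mul (atom 5) (mul (atom 2) (atom 0)))
  | _ => const 0

/-- `∂_t` of the atoms (`θ` held fixed): `t ↦ 1`, `sin(t cos θ) ↦ cos(t cos θ)·cos θ`, … -/
def TT : ℕ → JE
  | 2 => const 1
  | 3 => mul (atom 4) (atom 0)
  | 4 => neg (mul (atom 3) (atom 0))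
  | 5 => mul (atom 6) (atom 1)
  | 6 => neg (mul (atom 5) (atom 1))
  | _ => const 0

/-- Formal derivative of a `divW`-free expression along a derivation given on the atoms by the table `T`
(on `divW` nodes: junk `0`, never used). -/
def pd (T : ℕ → JE) : JE → JE
  | atom i => T i
  | const _ => const 0
  | add a b => add' (pd T a) (pd T b)
  | mul a b => add' (mul' (pd T a) b) (mul' a (pd T b))
  | neg a => neg' (pd T a)
  | divW _ _ => const 0

/-- The level function `F = -2(cos(t cos θ) + cos(t sin θ))` in the atoms. -/
def F0 : JE := mul (const (-2)) (add (atom 4) (atom 6))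

/-- `∂_tF` in the atoms (the radial slope `W`; `eval_E01`). -/
def E01 : JE := pd TT F0

/-- `∂_θF` in the atoms (`eval_E10`). -/
def E10 : JE := pd TTH F0

/-- The angular slope of the curve `u' = -∂_θF/∂_tF` in the atoms (`eval_V`). -/
def V : JE := neg' (divW' E10 1)

/-- The curve derivation on `divW`-free expressions: `d/dθ` along `θ ↦ (θ, u_μ(θ))`, i.e. `∂_θ + u'·∂_t` on the atoms, Leibniz on
sums and products (on `divW` nodes: junk `0`). -/
def DcDF : JE → JE
  | atom i => if i = 2 then V else add' (TTH i) (mul' (TT i) V)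
  | const _ => const 0
  | add a b => add' (DcDF a) (DcDF b)
  | mul a b => add' (mul' (DcDF a) b) (mul' a (DcDF b))
  | neg a => neg' (DcDF a)
  | divW _ _ => const 0

/-- The curve derivative of the radial slope `W = E01` (a fixed `divW`-free term). -/
def DW : JE := DcDF E01

/-- **The curve derivation** `Dc`: `d/dθ` along the curve `θ ↦ (θ, u_μ(θ))` of an arbitrary jet expression — as `DcDF` on the
polynomial constructors, and the quotient rule `(a/Wⁿ)' = (a'·W - n·a·W')/Wⁿ⁺¹` on `divW`. -/
def Dc : JE → JE
  | atom i => if i = 2 then V else add' (TTH i) (mul' (TT i) V)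
  | const _ => const 0
  | add a b => add' (Dc a) (Dc b)
  | mul a b => add' (mul' (Dc a) b) (mul' a (Dc b))
  | neg a => neg' (Dc a)
  | divW a n => divW' (sub' (mul' (Dc a) E01) (mul' (smul' n a) DW)) (n + 1)

/-- `divW`-free expressions. -/
def divFree : JE → Bool
  | atom _ => true
  | const _ => true
  | add a b => divFree a && divFree b
  | mul a b => divFree a && divFree b
  | neg a => divFree a
  | divW _ _ => false

/-- Node count of a jet expression (as a tree, without sharing). -/
def size : JE → ℕ
  | atom _ => 1
  | const _ => 1
  | add a b => size a + size b + 1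
  | mul a b => size a + size b + 1
  | neg a => size a + 1
  | divW a _ => size a + 1

/-- On `divW`-free expressions the two derivations agree. -/
theorem Dc_eq_DcDF : ∀ {e : JE}, e.divFree = true → Dc e = DcDF e
  | atom _, _ => rfl
  | const _, _ => rfl
  | add a b, h => by
      simp only [divFree, Bool.and_eq_true] at h
      simp only [Dc, DcDF, Dc_eq_DcDF h.1, Dc_eq_DcDF h.2]
  | mul a b, h => by
      simp only [divFree, Bool.and_eq_true] at h
      simp only [Dc, DcDF, Dc_eq_DcDF h.1, Dc_eq_DcDF h.2]
  | neg a, h => by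
      simp only [divFree] at h
      simp only [Dc, DcDF, Dc_eq_DcDF h]
  | divW _ _, h => by simp [divFree] at h

/-- `E01` is `divW`-free. -/
theorem divFree_E01 : E01.divFree = true := by decide

/-- `Dc E01 = DW` (so the quotient rule in `Dc` uses the curve derivative of `W`). -/
theorem Dc_E01 : Dc E01 = DW := Dc_eq_DcDF divFree_E01

end JE

end Summit.HubbardSuperconductivity.HubbardSuperconductivity.Theorems.FreeBandJets

end
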